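import Summits.ABC.IUTFork.Thm311RealInd1StripTwistMoverOddWindow
import Summits.ABC.IUTFork.Thm311RealInd1StripTwistMoverJWAllOdd
import HarnessLib

/-!
# [IUTchIII] Thm 3.11 (i) (Ind1) at `v ∈ 𝕍^non`: the Jannsen–Wingberg planes REALISED in print's strip part (reusable package),
# and the windowed/outward mover of record — modulo `DehnTwistTransvectionsOnUnitsAll`

PROOF-ONLY file (abc-iut cell, Cor. 3.12 sub-crew, seat abc-iut-c312-1 = holder of record of the typed [IUTchIII] Thm. 3.11,
gen 10; row «R11 IND1-STRIP-MOVER-ALL-PLANES», part e).  TAKES NO SIDE on [IUTchIII] Cor. 3.12.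

* **`Real.exists_realised_planes_of_dehnTwistsAll`** — the plumbing of `Thm311RealInd1StripTwistMoverJWAllOdd` (p480550) packaged
  ONCE for consumers: assuming the master named fact `DehnTwistTransvectionsOnUnitsAll` (K. Kondo arXiv:2512.09231 §2, proof of
  Thm. 2.3 p. 10; Jannsen–Wingberg = NSW Thm. 7.5.14; Hoshi–Nishio 2022 Lemma 1.3), at every finite place `v ∣ p` of a number
  field `F` with `p` odd and `[K_v : ℚ_p] ≥ 3` there are `c ≤ 2`, `g` with `[K_v : ℚ_p] = c + 2g`, a Kronecker family of `g`
  twist planes `(ya i, yb i; ca i, cb i)` of `K_v` (abc-iut-S7's rescaled norm) over `ℚ_p`, and elements `ψ i, ψ' i` of print's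
  (Ind1) strip part `Real.ind1StripOf v (Real.galoisLog v)` acting as the `2g` elementary transvections
  `x ↦ x + cb i x • ya i`, `x ↦ x − ca i x • yb i` (THE equivariant lift read through the Galois `p`-adic logarithm —
  `realises_galoisLog_of_liftActsOnUnitLogAs`; continuity from finite dimension over `ℚ_p`).
* **`Real.exists_mem_ind1StripOf_galoisLog_mapsOut_closedBall_of_dehnTwistsAll_odd`** / `…_analyticLogv_…` — STATEMENTS OF
  RECORD (windowed, outward): assuming the fact, at every `v ∣ p` odd with `f(v|p)` ODD and `e(v|p) ≥ 3`, for EVERY `k ∈ ℤ`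
  there are `χ ∈ Real.ind1StripOf v (Real.galoisLog v)`, `m` with `k ≤ m ≤ k + e(v|p)` and `x ∈ 𝔪_v^m = B(0,‖ϖ‖^m)` with
  `χ(x) ∉ 𝔪_v^m` — every ideal-shaped region has, within `e(v|p)` steps below it, a region that print's (Ind1) strip part
  STRICTLY inflates (`Thm311RealInd1StripTwistMoverOddWindow`).
HONEST SCOPE: conditional on a named classical fact (binder `hJW`); statements about OUR typed objects at ONE place; nothing here
asserts or refutes [IUTchIII] Cor. 3.12.  [claim: Mochizuki2012, status: disputed]; [cite: Kondo2025OuterAutMLF, §2 Thm 2.1 and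
proof of Thm 2.3 p.10]; [cite: NeukirchSchmidtWingberg2008, Thm 7.5.14]; [cite: DupuyHilado2025, §4.7].  typed ≠ proved; a
conditional theorem discharges nothing it binds.
-/

set_option autoImplicit false

noncomputable section

open Metric Set
open scoped Pointwise

namespace Summit.ABC.IUTFork.Thm311.Real

open NumberField IsDedekindDomain Literature.NumberTheory.NumberFields Literature.IUT.LogVolume
open Literature.NumberTheory.GaloisRepresentations Literature.NumberTheory.GaloisRepresentations.Ultrametric
open Literature.AnabelianGeometry.AbsoluteAnabelian Literature.IUT.HodgeArakelov
open Literature.IUT.HodgeArakelov.AbsTopMonoids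

variable {F : Type} [Field F] [NumberField F] (v : HeightOneSpectrum (𝓞 F))

/-- **The Jannsen–Wingberg planes, REALISED in print's (Ind1) strip part** (reusable package).  Assume
`DehnTwistTransvectionsOnUnitsAll`.  At a finite place `v ∣ p` of `F` with `p` odd and `[K_v : ℚ_p] = e(v|p) f(v|p) ≥ 3` there are
`c ≤ 2`, `g`, with `[K_v : ℚ_p] = c + 2g`, a family of `g` twist planes `(ya i, yb i; ca i, cb i)` of `K_v` (rescaled norm) over
`ℚ_p` with the Kronecker dualities, and `ψ i, ψ' i ∈ Real.ind1StripOf v (Real.galoisLog v)` acting on `K_v` as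
`x ↦ x + cb i x • ya i` and `x ↦ x − ca i x • yb i`.  (The fact's basis `y : Fin c ⊕ Fin g × Fin 2`; plane `i` =
`(y (inr (i,0)), y (inr (i,1)))`; `ψ i, ψ' i` = the transvections as continuous linear automorphisms, realised by the fact's
`φ_i, φ'_i` through `realises_galoisLog_of_liftActsOnUnitLogAs`; transported along the identity `of : K_v ≃+* K`.)
[claim: Mochizuki2012, status: disputed] [cite: Kondo2025OuterAutMLF, §2 Thm 2.1 and proof of Thm 2.3 p.10] -/
theorem exists_realised_planes_of_dehnTwistsAll (hJW : DehnTwistTransvectionsOnUnitsAll)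
    (p : ℕ) [Fact p.Prime] (hv : ((p : ℕ) : 𝓞 F) ∈ v.asIdeal) (hp2 : p ≠ 2) (h3 : 3 ≤ localDeg F v) :
    ∃ (c g : ℕ) (_ : c ≤ 2) (_ : localDeg F v = c + 2 * g)
      (ca cb : Fin g → (RescaledCompletion F p v hv →ₗ[ℚ_[p]] ℚ_[p])) (ya yb : Fin g → RescaledCompletion F p v hv)
      (ψ ψ' : Fin g → (v.adicCompletion F ≃+ v.adicCompletion F)),
      (∀ i j, ca i (ya j) = if i = j then 1 else 0) ∧ (∀ i j, cb i (yb j) = if i = j then 1 else 0) ∧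
      (∀ i j, ca i (yb j) = 0) ∧ (∀ i j, cb i (ya j) = 0) ∧
      (∀ i, ψ i ∈ ind1StripOf v (galoisLog v)) ∧ (∀ i, ψ' i ∈ ind1StripOf v (galoisLog v)) ∧
      (∀ i (x : RescaledCompletion F p v hv),
        RescaledCompletion.of F p v hv (ψ i ((RescaledCompletion.of F p v hv).symm x)) = x + cb i x • ya i) ∧
      (∀ i (x : RescaledCompletion F p v hv),
        RescaledCompletion.of F p v hv (ψ' i ((RescaledCompletion.of F p v hv).symm x)) = x - ca i x • yb i) := by
  -- `p` IS the residue characteristic of `K_v`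
  obtain rfl : p = (closureAt v).residueChar := eq_residueChar_closureAt_of_natCast_mem v hv
  have hpk : ValuativeRel.valuation (v.adicCompletion F) (closureAt v).residueChar < 1 :=
    LocalField.valuation_adicCompletion_natCast_lt_one v (closureAt v).residueChar hv
  -- the canonical `ℚ_p`-structure of `K_v` (the fact's `LocalField.padicAlgebra`; = abc-iut-S7's on the rescaled completion)
  haveI : CharZero (closureAt v).k := (closureAt v).instChar
  letI iQ : Algebra ℚ_[(closureAt v).residueChar] (closureAt v).k :=
    LocalField.padicAlgebra (closureAt v).k (closureAt v).residueChar hpk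
  -- `[K_v : ℚ_p] ≥ 3` in the fact's currency
  have hlocal : localDeg F v = Module.finrank ℚ_[(closureAt v).residueChar] (closureAt v).k := by
    exact RescaledCompletion.localDeg_eq_finrank F (closureAt v).residueChar v hv
  have hfin : 3 ≤ Module.finrank ℚ_[(closureAt v).residueChar] (closureAt v).k := by
    rw [← hlocal]; exact h3
  -- the twists: ONE basis `y : Fin c ⊕ Fin g × Fin 2`, `c ≤ 2`, all `g` planes realised
  obtain ⟨c, g, hc, y, hplanes⟩ := hJW (closureAt v) (closureAt v).residueChar hpk hp2 hfin
  have h1 := fun i => (hplanes i).1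
  have h2 := fun i => (hplanes i).2
  choose φ hφ using h1
  choose φ' hφ' using h2
  -- `[K_v : ℚ_p] = c + 2g`
  have hcard : localDeg F v = c + 2 * g := by
    rw [hlocal, Module.finrank_eq_card_basis y, Fintype.card_sum, Fintype.card_prod, Fintype.card_fin, Fintype.card_fin,
      Fintype.card_fin]
    omega
  -- the module topology of `K_v` over `ℚ_p`: linear maps are continuous
  haveI : ContinuousSMul ℚ_[(closureAt v).residueChar] (closureAt v).k :=
    continuousSMul_of_algebraMap ℚ_[(closureAt v).residueChar] _
      (by exact LocalField.continuous_algebraMap_adicCompletionPadicAlgebra v (closureAt v).residueChar hv)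
  haveI : FiniteDimensional ℚ_[(closureAt v).residueChar] (closureAt v).k :=
    Module.finite_of_finrank_pos (by omega)
  -- Kronecker dualities of the basis coordinates
  have hcoord : ∀ s t : Fin c ⊕ Fin g × Fin 2, y.coord s (y t) = if t = s then 1 else 0 := by
    intro s t
    rw [Module.Basis.coord_apply, Module.Basis.repr_self, Finsupp.single_apply]
  have haa : ∀ i j : Fin g, y.coord (Sum.inr (i, 0)) (y (Sum.inr (j, 0))) = if i = j then 1 else 0 := by
    intro i j
    rw [hcoord]
    by_cases h : i = j
    · subst h; rw [if_pos rfl, if_pos rfl]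
    · rw [if_neg h, if_neg]
      intro h'
      simp only [Sum.inr.injEq, Prod.mk.injEq] at h'
      exact h h'.1.symm
  have hbb : ∀ i j : Fin g, y.coord (Sum.inr (i, 1)) (y (Sum.inr (j, 1))) = if i = j then 1 else 0 := by
    intro i j
    rw [hcoord]
    by_cases h : i = j
    · subst h; rw [if_pos rfl, if_pos rfl]
    · rw [if_neg h, if_neg]
      intro h'
      simp only [Sum.inr.injEq, Prod.mk.injEq] at h'
      exact h h'.1.symm
  have hab : ∀ i j : Fin g, y.coord (Sum.inr (i, 0)) (y (Sum.inr (j, 1))) = 0 := by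
    intro i j
    rw [hcoord, if_neg]
    intro h'
    simp only [Sum.inr.injEq, Prod.mk.injEq] at h'
    exact absurd h'.2 (by decide)
  have hba : ∀ i j : Fin g, y.coord (Sum.inr (i, 1)) (y (Sum.inr (j, 0))) = 0 := by
    intro i j
    rw [hcoord, if_neg]
    intro h'
    simp only [Sum.inr.injEq, Prod.mk.injEq] at h'
    exact absurd h'.2 (by decide)
  -- the `2g` transvections as linear automorphisms of `K_v`
  let T : Fin g → ((closureAt v).k ≃ₗ[ℚ_[(closureAt v).residueChar]] (closureAt v).k) := fun i =>
    LinearEquiv.ofLinear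
      (LinearMap.id + (y.coord (Sum.inr (i, 1))).smulRight (y (Sum.inr (i, 0))))
      (LinearMap.id - (y.coord (Sum.inr (i, 1))).smulRight (y (Sum.inr (i, 0))))
      (by
        apply LinearMap.ext; intro x
        simp)
      (by
        apply LinearMap.ext; intro x
        simp)
  let T' : Fin g → ((closureAt v).k ≃ₗ[ℚ_[(closureAt v).residueChar]] (closureAt v).k) := fun i =>
    LinearEquiv.ofLinear
      (LinearMap.id - (y.coord (Sum.inr (i, 0))).smulRight (y (Sum.inr (i, 1))))
      (LinearMap.id + (y.coord (Sum.inr (i, 0))).smulRight (y (Sum.inr (i, 1))))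
      (by
        apply LinearMap.ext; intro x
        simp)
      (by
        apply LinearMap.ext; intro x
        simp)
  have hTapply : ∀ i x, T i x = x + y.coord (Sum.inr (i, 1)) x • y (Sum.inr (i, 0)) := fun i x => rfl
  have hT'apply : ∀ i x, T' i x = x - y.coord (Sum.inr (i, 0)) x • y (Sum.inr (i, 1)) := fun i x => rfl
  -- membership in print's (Ind1) strip part over the Galois logarithm (continuity: finite dimension over `ℚ_p`)
  have hψ : ∀ i, (T i).toAddEquiv ∈ ind1StripOf v (galoisLog v) := fun i =>
    ⟨by exact (T i).toLinearMap.continuous_of_finiteDimensional,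
      by exact (T i).symm.toLinearMap.continuous_of_finiteDimensional, φ i,
      realises_galoisLog_of_liftActsOnUnitLogAs v hpk (φ i) _ (hφ i) (T i).toAddEquiv (hTapply i)⟩
  have hψ' : ∀ i, (T' i).toAddEquiv ∈ ind1StripOf v (galoisLog v) := fun i =>
    ⟨by exact (T' i).toLinearMap.continuous_of_finiteDimensional,
      by exact (T' i).symm.toLinearMap.continuous_of_finiteDimensional, φ' i,
      realises_galoisLog_of_liftActsOnUnitLogAs v hpk (φ' i) _ (hφ' i) (T' i).toAddEquiv (hT'apply i)⟩
  -- transport of the twist data to the rescaled norm (`of` is the identity of `K_v`, `ℚ_p`-linear)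
  let e := RescaledCompletion.of F (closureAt v).residueChar v hv
  let eL : (closureAt v).k ≃ₗ[ℚ_[(closureAt v).residueChar]] RescaledCompletion F (closureAt v).residueChar v hv :=
    { e.toAddEquiv with
      map_smul' := fun c x => by
        change e (c • x) = c • e x
        rw [Algebra.smul_def, Algebra.smul_def, map_mul]
        rfl }
  have heL : ∀ x, eL x = e x := fun x => rfl
  have heLs : ∀ x, eL.symm x = e.symm x := fun x => rfl
  refine ⟨c, g, hc, hcard,
    fun i => (y.coord (Sum.inr (i, 0))).comp eL.symm.toLinearMap,
    fun i => (y.coord (Sum.inr (i, 1))).comp eL.symm.toLinearMap,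
    fun i => eL (y (Sum.inr (i, 0))), fun i => eL (y (Sum.inr (i, 1))),
    fun i => (T i).toAddEquiv, fun i => (T' i).toAddEquiv, ?_, ?_, ?_, ?_, hψ, hψ', ?_, ?_⟩
  · intro i j
    change y.coord (Sum.inr (i, 0)) (eL.symm (eL (y (Sum.inr (j, 0))))) = _
    rw [LinearEquiv.symm_apply_apply, haa]
  · intro i j
    change y.coord (Sum.inr (i, 1)) (eL.symm (eL (y (Sum.inr (j, 1))))) = _
    rw [LinearEquiv.symm_apply_apply, hbb]
  · intro i j
    change y.coord (Sum.inr (i, 0)) (eL.symm (eL (y (Sum.inr (j, 1))))) = 0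
    rw [LinearEquiv.symm_apply_apply, hab]
  · intro i j
    change y.coord (Sum.inr (i, 1)) (eL.symm (eL (y (Sum.inr (j, 0))))) = 0
    rw [LinearEquiv.symm_apply_apply, hba]
  · intro i x
    change e (T i (e.symm x)) = x + y.coord (Sum.inr (i, 1)) (eL.symm x) • eL (y (Sum.inr (i, 0)))
    rw [hTapply, map_add, RingEquiv.apply_symm_apply, ← heL, ← heLs, map_smul]
  · intro i x
    change e (T' i (e.symm x)) = x - y.coord (Sum.inr (i, 0)) (eL.symm x) • eL (y (Sum.inr (i, 1)))
    rw [hT'apply, map_sub, RingEquiv.apply_symm_apply, ← heL, ← heLs, map_smul]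

/-- **STATEMENT OF RECORD (windowed, outward): PRINT'S (Ind1) STRIP PART STRICTLY INFLATES AN IDEAL-SHAPED REGION IN EVERY
WINDOW OF `e(v|p) + 1` CONSECUTIVE ONES — at every `v ∣ p` odd with `f(v|p)` ODD and `e(v|p) ≥ 3`, modulo the Jannsen–Wingberg
fact for all planes.**  Assume `DehnTwistTransvectionsOnUnitsAll`.  Then for every `k ∈ ℤ` there are
`χ ∈ Real.ind1StripOf v (Real.galoisLog v)`, `m ∈ ℤ` with `k ≤ m ≤ k + e(v|p)`, and `x ∈ 𝔪_v^m = B(0,‖ϖ‖^m)` (abc-iut-S7's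
rescaled norm, `ϖ` a uniformizer) with `χ(x) ∉ 𝔪_v^m`.  (`exists_realised_planes_of_dehnTwistsAll` +
`exists_mem_ind1StripOf_mapsOut_closedBall_of_planes`; `[K_v : ℚ_p] = c + 2g ≤ 2 + 2g < e(v|p) + 2g`.)  Contrast: print's (Ind2)
moves no ball (`image_closedBall_eq_of_mem_ismIsm`); Dupuy–Hilado's (Ind1) is `{1}`.
[claim: Mochizuki2012, status: disputed] [cite: Kondo2025OuterAutMLF, §2 Thm 2.1 and proof of Thm 2.3 p.10]
[cite: DupuyHilado2025, §4.7] -/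
theorem exists_mem_ind1StripOf_galoisLog_mapsOut_closedBall_of_dehnTwistsAll_odd (hJW : DehnTwistTransvectionsOnUnitsAll)
    (p : ℕ) [Fact p.Prime] (hv : ((p : ℕ) : 𝓞 F) ∈ v.asIdeal) (hp2 : p ≠ 2)
    (hf : Odd (v.asIdeal.inertiaDeg ℤ)) (he : 3 ≤ v.asIdeal.ramificationIdx ℤ)
    {ϖ : (RescaledCompletion F p v hv)ˣ} (hϖ : IsUniformizer ϖ) (k : ℤ) :
    ∃ χ ∈ ind1StripOf v (galoisLog v), ∃ m : ℤ, k ≤ m ∧ m ≤ k + v.asIdeal.ramificationIdx ℤ ∧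
      ∃ x ∈ closedBall (0 : RescaledCompletion F p v hv) (‖(ϖ : RescaledCompletion F p v hv)‖ ^ m),
        RescaledCompletion.of F p v hv (χ ((RescaledCompletion.of F p v hv).symm x)) ∉
          closedBall (0 : RescaledCompletion F p v hv) (‖(ϖ : RescaledCompletion F p v hv)‖ ^ m) := by
  have h3 : 3 ≤ localDeg F v := by
    rw [localDeg]; exact he.trans (Nat.le_mul_of_pos_right _ hf.pos)
  obtain ⟨c, g, hc, hcard, ca, cb, ya, yb, ψ, ψ', haa, hbb, hab, hba, hψ, hψ', hT, hT'⟩ :=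
    exists_realised_planes_of_dehnTwistsAll v hJW p hv hp2 h3
  have hdim : localDeg F v < v.asIdeal.ramificationIdx ℤ + 2 * Fintype.card (Fin g) := by
    rw [Fintype.card_fin]; omega
  exact exists_mem_ind1StripOf_mapsOut_closedBall_of_planes p v hv hf (galoisLog v) hϖ hdim haa hbb hab hba hψ hψ' hT hT' k

/-- **The same over abc-iut-c312-5's ANALYTIC logarithm** (`Real.galoisLog_eq_analyticLogv`, w5-d216 p452975).
[claim: Mochizuki2012, status: disputed] [cite: Kondo2025OuterAutMLF, §2 Thm 2.1 and proof of Thm 2.3 p.10] -/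
theorem exists_mem_ind1StripOf_analyticLogv_mapsOut_closedBall_of_dehnTwistsAll_odd
    (hJW : DehnTwistTransvectionsOnUnitsAll) (p : ℕ) [Fact p.Prime] (hv : ((p : ℕ) : 𝓞 F) ∈ v.asIdeal) (hp2 : p ≠ 2)
    (hf : Odd (v.asIdeal.inertiaDeg ℤ)) (he : 3 ≤ v.asIdeal.ramificationIdx ℤ)
    {ϖ : (RescaledCompletion F p v hv)ˣ} (hϖ : IsUniformizer ϖ) (k : ℤ) :
    ∃ χ ∈ ind1StripOf v (analyticLogv F v), ∃ m : ℤ, k ≤ m ∧ m ≤ k + v.asIdeal.ramificationIdx ℤ ∧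
      ∃ x ∈ closedBall (0 : RescaledCompletion F p v hv) (‖(ϖ : RescaledCompletion F p v hv)‖ ^ m),
        RescaledCompletion.of F p v hv (χ ((RescaledCompletion.of F p v hv).symm x)) ∉
          closedBall (0 : RescaledCompletion F p v hv) (‖(ϖ : RescaledCompletion F p v hv)‖ ^ m) := by
  rw [← galoisLog_eq_analyticLogv]
  exact exists_mem_ind1StripOf_galoisLog_mapsOut_closedBall_of_dehnTwistsAll_odd v hJW p hv hp2 hf he hϖ k

end Summit.ABC.IUTFork.Thm311.Real

end
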